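import Literature.Computability.AlgebraicComplexity.NoncommutativeCircuits
import Summits.ValiantsHypothesis.ValiantsHypothesis.Theorems.NcSemantics
import HarnessLib

/-!
# NcLiteratureBridge — the Literature noncommutative semantics agrees with `NcSemantics`
(decomposition workshop `decomp-valiant`, lens 6 «restricted-models lifting axis», gen 5; supports
`DecompCycle1.PerNotSmVP`, stmt-ValiantsHypothesis-23661)

`Literature/Computability/AlgebraicComplexity/NoncommutativeCircuits.lean` (typed this gen so that
HWY10 Thm 1.7 and AS10 Thm 10 can be NAMED FACTS over Literature objects) and the summit-side
`Theorems/NcSemantics.lean` (over which the route `DecompCycle1` types its asides 23446–23448) define the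
same free-algebra semantics clause by clause. This file proves they coincide —
`ArithCircuit.ncEval P = NcSemantics.ncEval P` (`ncEval_eq`), `ncPerPoly k n = NcSemantics.ncPerPoly n`
(`rfl`) — and restates the dial pieces through the Literature size predicate:

* `perNotNcVP_iff : A_nc ↔ ∀ c, ∃ n, ¬ HasNcCircuitSizeLE (ncPerPoly ℂ n) (n ^ c + c)`;
* `ncLift_iff : B_nc ↔ (VP ℂ = VNP ℂ → ∃ c, ∀ n, HasNcCircuitSizeLE (ncPerPoly ℂ n) (n ^ c + c))`.

Bookkeeping only; nothing here bears on `VP ≠ VNP`.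

## References

* [Nisan1991Noncommutative] N. Nisan, *Lower bounds for non-commutative computation*, STOC 1991, §1.
* [HrubesWigdersonYehudayoff2010] P. Hrubeš, A. Wigderson, A. Yehudayoff, STOC 2010, §1.1, §2.
-/

noncomputable section

namespace Summit.ValiantsHypothesis.ValiantsHypothesis.Theorems.NcLiteratureBridge

open Literature.Computability.AlgebraicComplexity
open Summit.ValiantsHypothesis.ValiantsHypothesis.Theorems

universe u v

variable {k : Type u} {σ : Type v} [CommSemiring k]

/-- Operand clause agreement. [cite: Nisan1991Noncommutative, §1] -/
theorem operand_ncEval_eq (vals : List (FreeAlgebra k σ)) (u : ArithCircuit.Operand k σ) :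
    u.ncEval vals = NcSemantics.ncOperandEval vals u := by
  cases u <;> rfl

/-- Gate clause agreement. [cite: Nisan1991Noncommutative, §1] -/
theorem gate_ncEval_eq (vals : List (FreeAlgebra k σ)) (g : ArithCircuit.Gate k σ) :
    g.ncEval vals = NcSemantics.ncGateEval vals g := by
  cases g <;> simp only [ArithCircuit.Gate.ncEval, NcSemantics.ncGateEval, operand_ncEval_eq]

/-- Gate-value list agreement. [cite: Nisan1991Noncommutative, §1] -/
theorem ncGateValues_eq (gs : List (ArithCircuit.Gate k σ)) :
    ArithCircuit.ncGateValues gs = NcSemantics.ncGateValues gs := by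
  induction gs using List.reverseRecOn with
  | nil => rfl
  | append_singleton gs g ih =>
    rw [ArithCircuit.ncGateValues_append_singleton, NcSemantics.ncGateValues_append_singleton, ih,
      gate_ncEval_eq]

/-- **The Literature and the summit-side noncommutative semantics coincide.** [cite: Nisan1991Noncommutative, §1] -/
theorem ncEval_eq (P : ArithCircuit k σ) : P.ncEval = NcSemantics.ncEval P := by
  rw [ArithCircuit.ncEval, NcSemantics.ncEval, ncGateValues_eq, operand_ncEval_eq]

/-- The two ordered permanents coincide. [cite: HrubesWigdersonYehudayoff2010, §1.3] -/
theorem ncPerPoly_eq (n : ℕ) : ncPerPoly k n = NcSemantics.ncPerPoly n := rfl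

/-- The two commutative-image maps coincide. [cite: HrubesWigdersonYehudayoff2010, §1.1] -/
theorem commImage_eq : (commImage : FreeAlgebra k σ →ₐ[k] MvPolynomial σ k) = NcSemantics.comm := rfl

/-- The Literature size predicate, read on the summit-side semantics. [cite: HrubesWigdersonYehudayoff2010, §2] -/
theorem hasNcCircuitSizeLE_iff (f : FreeAlgebra k σ) (s : ℕ) :
    HasNcCircuitSizeLE f s ↔ ∃ P : ArithCircuit k σ, P.IsFanInTwo ∧ NcSemantics.ncEval P = f ∧ P.size ≤ s := by
  simp only [HasNcCircuitSizeLE, ncEval_eq]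

/-- `A_nc` through the Literature size predicate: for every exponent `c` some order `n` has NO
fan-in-two noncommutative circuit of size `≤ n^c + c` for the ordered permanent.
[cite: HrubesWigdersonYehudayoff2010, §1.1] -/
theorem perNotNcVP_iff :
    NcSemantics.PerNotNcVP ↔ ∀ c : ℕ, ∃ n : ℕ, ¬ HasNcCircuitSizeLE (ncPerPoly ℂ n) (n ^ c + c) := by
  simp only [NcSemantics.PerNotNcVP, hasNcCircuitSizeLE_iff, ncPerPoly_eq, not_exists, not_and, not_le]

/-- `B_nc` through the Literature size predicate. [cite: HrubesWigdersonYehudayoff2010, Thm F.1] -/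
theorem ncLift_iff :
    NcSemantics.NcLift ↔
      (VP ℂ = VNP ℂ → ∃ c : ℕ, ∀ n : ℕ, HasNcCircuitSizeLE (ncPerPoly ℂ n) (n ^ c + c)) := by
  simp only [NcSemantics.NcLift, hasNcCircuitSizeLE_iff, ncPerPoly_eq]

end Summit.ValiantsHypothesis.ValiantsHypothesis.Theorems.NcLiteratureBridge

end
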